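import Mathlib
import Literature.NumberTheory.LFunctions.Zhang2022.Section15CLemma153RpGlue
import HarnessLib

/-!
# Zhang (2022), App. A p. 105, Z22:§A.u031: `𝔲₁ⱼ(q,1) = (1−q⁻¹)² + O(α₁/q)` for `q ∣ D` — PROVED
# (exactly, with error `0`)

Topic `Literature/NumberTheory/LFunctions/Zhang2022` (Landau–Siegel audit tree; verdict-neutral).
Y. Zhang, *Discrete mean estimates and the Landau–Siegel zero*, arXiv:2211.02515v1 (2022)
[Zhang2022LandauSiegel], Appendix A p. 105, tex L5178 ("Further, in the case `q ≤ D` we have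
`𝔲_{1j}(q,1) = (1−q⁻¹)² + O(α₁/q)` if `q∣D`"), **an unrefereed manuscript under adjudication; nothing
here asserts or denies its Theorems 1–2.** Typed AS PRINTED as `Typed.AppendixA2.StepA_u031 c′`.

For a prime `q ∣ D` one has `χ(q) = 0`, so the Euler factor `𝔲₁ⱼ(q,s)` (`Typed.AppendixA2.frakU1Factor`,
equal to the repaired `frakU1FactorR` at such `q`, `frakU1FactorR_eq_of_dvd`) is EXACTLY
`(1 − q^{−s})²·ϖ₁ⱼ(1) = (1 − q^{−s})²` once `ϖ₁ⱼ(1) = 1`, which holds for all large `D` under (A)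
(`Typed.Section15B.inline15_varpiMult_holds`). Hence the node holds with implied constant `0`.
This file PROVES `Typed.AppendixA2.stepA_u031_holds : StepA_u031 c′` (theorems only).

## References

* Y. Zhang, arXiv:2211.02515v1 (2022), App. A p. 105 (tex L5178). [cite: Zhang2022LandauSiegel, App. A p. 105]
-/

noncomputable section

open Complex Real

namespace Literature.NumberTheory.LFunctions.Zhang2022.Typed.AppendixA2

open Literature.NumberTheory.LFunctions.Zhang2022
open Literature.NumberTheory.LFunctions.Zhang2022.Skeleton
open Literature.NumberTheory.LFunctions.Zhang2022.Typed.Section15B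

/-- **The Euler factor at `q ∣ D`, `s = 1`, exactly**: `𝔲₁ⱼ(q,1) = (1 − q⁻¹)²` when `ϖ₁ⱼ(1) = 1`.
[cite: Zhang2022LandauSiegel, App. A p. 105, tex L5178] -/
theorem frakU1Factor_one_eq_of_dvd (c' : ℝ) {D : ℕ} [NeZero D] (χ : DirichletCharacter ℂ D) (j : ℕ)
    {q : ℕ} (hq : q.Prime) (hqD : q ∣ D) (h1 : varpi1 c' χ j 1 = 1) :
    frakU1Factor c' χ j q 1 = (1 - (q : ℂ)⁻¹) ^ 2 := by
  rw [← frakU1FactorR_eq_of_dvd c' χ j hq hqD,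
    Section15C.frakU1FactorR_eq_of_dvd_of_varpi1_one c' χ j hq hqD h1 1, Complex.cpow_neg_one]

/-- **Z22:§A.u031 HOLDS** (`Typed.AppendixA2.StepA_u031 c′`, App. A p. 105 tex L5178): for all large
`D`, under (A), `1 ≤ j ≤ 3`, every prime `q ∣ D` (`q ≤ D`): `‖𝔲₁ⱼ(q,1) − (1−q⁻¹)²‖ ≤ 0·(α𝓛/q)` — the
printed `O(α₁/q)` holds with constant `0` since the factor is exactly `(1−q⁻¹)²`
(`frakU1Factor_one_eq_of_dvd`, `ϖ₁ⱼ(1) = 1` by `inline15_varpiMult_holds`).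
[cite: Zhang2022LandauSiegel, App. A p. 105, tex L5178] -/
theorem stepA_u031_holds (c' : ℝ) : StepA_u031 c' := by
  refine ⟨0, (inline15_varpiMult_holds c').mono fun D _ χ _ _ hmult hA j hj q hq _ hqD => ?_⟩
  have h1 : varpi1 c' χ j 1 = 1 := (hmult hA j hj).1
  rw [frakU1Factor_one_eq_of_dvd c' χ j hq hqD h1, sub_self, norm_zero, zero_mul]

variable (c' : ℝ) in
/-- `StepA_u031` — `_holds` alias of `stepA_u031_holds` above under the fact's exact name, stated under the
prover's own binders as section variables (appended 2026-08-28, D-0026 bookkeeping: the proof term is the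
existing theorem of this file; no statement, definition or attribute is edited; no new named fact; the
ledger's debt table listed the fact unproved). [cite: Zhang2022LandauSiegel, App. A p. 105, tex L5178] -/
theorem _root_.Literature.NumberTheory.LFunctions.Zhang2022.Typed.AppendixA2.StepA_u031_holds :
    _root_.Literature.NumberTheory.LFunctions.Zhang2022.Typed.AppendixA2.StepA_u031 c' :=
  _root_.Literature.NumberTheory.LFunctions.Zhang2022.Typed.AppendixA2.stepA_u031_holds (c' := c')

end Literature.NumberTheory.LFunctions.Zhang2022.Typed.AppendixA2

end
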